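/-
Copyright (c) 2026. Released under Apache 2.0 license.
Literature formalization: Chen–Voutier, Lemma 4 and Siegel's identity for the Padé numerators.
-/
import Mathlib
import Literature.NumberTheory.DiophantineApproximation.BinomialPadeIdentities
import Literature.NumberTheory.DiophantineApproximation.QuarticHypergeometricDenominators

/-!
# Expansion of the Padé polynomials at `x = 1`, and integrality for `α = 1/4`

[cite: ChenVoutier1997, §3.1 (Siegel's identity for `X_r^*(u',z')`) and Lemma 4 (arXiv:1401.5450)]

J. H. Chen and P. M. Voutier, *Complete solution of the Diophantine equation `X² + 1 = dY⁴` and a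
related family of quartic Thue equations*, J. Number Theory **62** (1997), 71–99.

For the Padé polynomials of Lemma 2,
`p_m(X) = ∑_{ν=0}^{m} C(m-α,m-ν) C(n+α,ν) X^ν` and `q_n(X) = ∑_{ν=0}^{n} C(m-α,ν) C(n+α,n-ν) X^ν`,
the second identity in the proof of Lemma 2,
`∑_{ν=k}^{m} C(m-α,m-ν) C(n+α,ν) C(ν,k) = C(n+α,k) C(m+n-k,n)` (`k ≤ m`), is exactly the statement
that the Taylor expansion of `p_m` at `X = 1` is
`p_m(X) = ∑_{s=0}^{m} C(n+α,s) C(m+n-s,n) (X-1)^s` (`binomialPadeP_eq_sum_pow_sub_one`), and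
symmetrically `q_n(X) = ∑_{s=0}^{n} C(m-α,s) C(m+n-s,m) (X-1)^s`.  For `m = n = r` and `α = 1/n`
this is the identity of Siegel quoted in §3.1,
`X_r^*(u',z') = (4^r r!/(3·7⋯(4r-1))) C(2r,r) (z')^r ₂F₁(-r,-r-1/4;-2r;1-w⁻¹)`
(recall `p_r = C(r-1/4,r) X_{4,r}` and `C(r-1/4,r) = 3·7⋯(4r-1)/(4^r r!)`), since
`C(2r,r) ₂F₁(-r,-r-1/4;-2r;y) = ∑_s (-1)^s C(2r-s,r) (l_s/(4^s s!)) y^s`, `l_s = ∏_{k=r-s+1}^{r}(4k+1)`,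
and `C(r+1/4,s) = l_s/(4^s s!)`.

Combined with Lemma 4 for `n = 4` (`μ_4 = 2`: `s! ∣ 2^s ∏ (4k ± 1)`,
`QuarticHypergeometricDenominators`), the coefficients `8^s C(r ± 1/4, s) C(2r-s,r)` of the
expansions in powers of `(X-1)/8` are rational integers (`eight_pow_mul_choose_add_quarter`,
`eight_pow_mul_choose_sub_quarter` and the `_mul_choose_natCast` forms), which is how §3.1 obtains
the integrality of `M X_r^*(u',z')` and `M X_r^*(z',u')` (`1 - w = -8/u'`, `1 - w⁻¹ = 8/z'`).
-/

open Finset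

namespace Literature.NumberTheory.DiophantineApproximation

/-! ### Taylor expansion of `p_m` and `q_n` at `X = 1` -/

/-- **Expansion of `p_m` at `1`** [cite: ChenVoutier1997, proof of Lemma 2 (second identity) and
§3.1 (Siegel's identity)]: for any complex `x`,
`∑_{ν=0}^{m} C(m-α,m-ν) C(n+α,ν) x^ν = ∑_{s=0}^{m} C(n+α,s) C(m+n-s,n) (x-1)^s`. -/
theorem binomialPadeP_eq_sum_pow_sub_one (α : ℝ) (m n : ℕ) (x : ℂ) :
    ∑ ν ∈ range (m + 1), ((Ring.choose ((m : ℝ) - α) (m - ν) * Ring.choose ((n : ℝ) + α) ν :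
        ℝ) : ℂ) * x ^ ν =
      ∑ s ∈ range (m + 1), ((Ring.choose ((n : ℝ) + α) s * Ring.choose ((m : ℝ) + n - s) n :
        ℝ) : ℂ) * (x - 1) ^ s := by
  -- expand `x ^ ν = ((x - 1) + 1) ^ ν` and pad the inner sum to `range (m + 1)`
  have hpow : ∀ ν ∈ range (m + 1), x ^ ν =
      ∑ s ∈ range (m + 1), ((ν.choose s : ℕ) : ℂ) * (x - 1) ^ s := by
    intro ν hν
    have hνm : ν ≤ m := Nat.lt_succ_iff.mp (mem_range.mp hν)
    rw [show x = (x - 1) + 1 by ring, add_pow]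
    simp only [one_pow, mul_one, add_sub_cancel_right]
    rw [← sum_range_add_sum_Ico _ (Nat.succ_le_succ hνm), sum_eq_zero (s := Ico _ _)
      (fun s hs => by rw [Nat.choose_eq_zero_of_lt (Nat.lt_of_succ_le (mem_Ico.mp hs).1),
        Nat.cast_zero, zero_mul]), add_zero]
    exact sum_congr rfl fun s _ => by ring
  calc _ = ∑ ν ∈ range (m + 1), ∑ s ∈ range (m + 1),
        ((Ring.choose ((m : ℝ) - α) (m - ν) * Ring.choose ((n : ℝ) + α) ν *
          Ring.choose (ν : ℝ) s : ℝ) : ℂ) * (x - 1) ^ s := by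
        refine sum_congr rfl fun ν hν => ?_
        rw [hpow ν hν, mul_sum]
        refine sum_congr rfl fun s _ => ?_
        rw [ring_choose_natCast']
        push_cast
        ring
    _ = ∑ s ∈ range (m + 1), ∑ ν ∈ range (m + 1),
        ((Ring.choose ((m : ℝ) - α) (m - ν) * Ring.choose ((n : ℝ) + α) ν *
          Ring.choose (ν : ℝ) s : ℝ) : ℂ) * (x - 1) ^ s := sum_comm
    _ = _ := by
        refine sum_congr rfl fun s hs => ?_
        rw [← sum_mul, ← Complex.ofReal_sum,
          sum_pcoeff_mul_choose α n (Nat.lt_succ_iff.mp (mem_range.mp hs))]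

/-- **Expansion of `q_n` at `1`** (the symmetric statement, `(m, n, α) ↦ (n, m, -α)`): for any
complex `x`, `∑_{ν=0}^{n} C(m-α,ν) C(n+α,n-ν) x^ν = ∑_{s=0}^{n} C(m-α,s) C(m+n-s,m) (x-1)^s`
[cite: ChenVoutier1997, proof of Lemma 2 and §3.1]. -/
theorem binomialPadeQ_eq_sum_pow_sub_one (α : ℝ) (m n : ℕ) (x : ℂ) :
    ∑ ν ∈ range (n + 1), ((Ring.choose ((m : ℝ) - α) ν * Ring.choose ((n : ℝ) + α) (n - ν) :
        ℝ) : ℂ) * x ^ ν =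
      ∑ s ∈ range (n + 1), ((Ring.choose ((m : ℝ) - α) s * Ring.choose ((m : ℝ) + n - s) m :
        ℝ) : ℂ) * (x - 1) ^ s := by
  have h := binomialPadeP_eq_sum_pow_sub_one (-α) n m x
  have e1 : ∀ ν, Ring.choose ((n : ℝ) - -α) (n - ν) * Ring.choose ((m : ℝ) + -α) ν =
      Ring.choose ((m : ℝ) - α) ν * Ring.choose ((n : ℝ) + α) (n - ν) := by
    intro ν; rw [sub_neg_eq_add, ← sub_eq_add_neg, mul_comm]
  have e2 : ∀ s, Ring.choose ((m : ℝ) + -α) s * Ring.choose ((n : ℝ) + m - s) m =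
      Ring.choose ((m : ℝ) - α) s * Ring.choose ((m : ℝ) + n - s) m := by
    intro s; rw [← sub_eq_add_neg, add_comm (n : ℝ)]
  simp only [e1, e2] at h
  exact h

/-! ### Integrality for `α = 1/4` (Lemma 4 with `n = 4`, `μ₄ = 2`) -/

/-- `8^s C(r+1/4, s) = 2^s ∏_{k=r-s+1}^{r} (4k+1) / s!` for `s ≤ r`
[cite: ChenVoutier1997, proof of Lemma 4, `l_s = ∏ (kn - j)` with `n = 4`, `j = -1`]. -/
theorem eight_pow_mul_choose_add_quarter {r s : ℕ} (hs : s ≤ r) :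
    (8 : ℝ) ^ s * Ring.choose ((r : ℝ) + 1 / 4) s =
      ((2 ^ s * ∏ i ∈ range s, (4 * (r - s + 1 + i) + 1) : ℕ) : ℝ) / s.factorial := by
  rw [ring_choose_eq_prod_div, mul_div_assoc']
  congr 1
  push_cast [Nat.cast_sub hs]
  rw [← prod_range_reflect (fun i => (4 * ((r : ℝ) - s + 1 + i) + 1)) s,
    pow_eq_prod_const, pow_eq_prod_const, ← prod_mul_distrib, ← prod_mul_distrib]
  refine prod_congr rfl fun l hl => ?_
  have hl' : l < s := mem_range.mp hl
  rw [Nat.cast_sub (by omega : l ≤ s - 1), Nat.cast_sub (by omega : 1 ≤ s)]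
  push_cast
  ring

/-- `8^s C(r-1/4, s) = 2^s ∏_{k=r-s+1}^{r} (4k-1) / s!` for `s ≤ r`
[cite: ChenVoutier1997, proof of Lemma 4, with `n = 4`, `j = 1`]. -/
theorem eight_pow_mul_choose_sub_quarter {r s : ℕ} (hs : s ≤ r) :
    (8 : ℝ) ^ s * Ring.choose ((r : ℝ) - 1 / 4) s =
      ((2 ^ s * ∏ i ∈ range s, (4 * (r - s + i) + 3) : ℕ) : ℝ) / s.factorial := by
  rw [ring_choose_eq_prod_div, mul_div_assoc']
  congr 1
  push_cast [Nat.cast_sub hs]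
  rw [← prod_range_reflect (fun i => (4 * ((r : ℝ) - s + i) + 3)) s,
    pow_eq_prod_const, pow_eq_prod_const, ← prod_mul_distrib, ← prod_mul_distrib]
  refine prod_congr rfl fun l hl => ?_
  have hl' : l < s := mem_range.mp hl
  rw [Nat.cast_sub (by omega : l ≤ s - 1), Nat.cast_sub (by omega : 1 ≤ s)]
  push_cast
  ring

/-- **Integrality of the scaled Taylor coefficients of `p_r` (`α = 1/4`)**
[cite: ChenVoutier1997, Lemma 4 and §3.1 ("`M X_r^*(u',z')` … are algebraic integers")]:
for `s ≤ r`, `8^s C(r+1/4,s) C(2r-s,r)` is the natural number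
`C(2r-s,r) · (2^s ∏_{k=r-s+1}^{r}(4k+1)) / s!` (an exact division). -/
theorem eight_pow_mul_choose_add_quarter_mul_choose {r s : ℕ} (hs : s ≤ r) :
    (8 : ℝ) ^ s * (Ring.choose ((r : ℝ) + 1 / 4) s * ((2 * r - s).choose r : ℝ)) =
      (((2 * r - s).choose r * ((2 ^ s * ∏ i ∈ range s, (4 * (r - s + 1 + i) + 1)) /
        s.factorial) : ℕ) : ℝ) := by
  rw [Nat.cast_mul, Nat.cast_div (factorial_dvd_two_pow_mul_prod (r - s + 1) s 1) (by positivity),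
    ← mul_assoc, eight_pow_mul_choose_add_quarter hs]
  ring

/-- **Integrality of the scaled Taylor coefficients of `q_r` (`α = 1/4`)**
[cite: ChenVoutier1997, Lemma 4 and §3.1]: for `s ≤ r`, `8^s C(r-1/4,s) C(2r-s,r)` is the
natural number `C(2r-s,r) · (2^s ∏_{k=r-s+1}^{r}(4k-1)) / s!` (an exact division). -/
theorem eight_pow_mul_choose_sub_quarter_mul_choose {r s : ℕ} (hs : s ≤ r) :
    (8 : ℝ) ^ s * (Ring.choose ((r : ℝ) - 1 / 4) s * ((2 * r - s).choose r : ℝ)) =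
      (((2 * r - s).choose r * ((2 ^ s * ∏ i ∈ range s, (4 * (r - s + i) + 3)) /
        s.factorial) : ℕ) : ℝ) := by
  rw [Nat.cast_mul, Nat.cast_div (factorial_dvd_two_pow_mul_prod (r - s) s 3) (by positivity),
    ← mul_assoc, eight_pow_mul_choose_sub_quarter hs]
  ring

/-- In the diagonal case `m = n = r` the real binomial `C(2r-s, r)` appearing in the expansions
at `1` is the ordinary one, for `s ≤ r` [folklore]. -/
theorem ring_choose_two_mul_sub (r s : ℕ) (hs : s ≤ r) :
    Ring.choose ((r : ℝ) + r - s) r = ((2 * r - s).choose r : ℝ) := by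
  rw [show (r : ℝ) + r - s = ((2 * r - s : ℕ) : ℝ) by push_cast [Nat.cast_sub (by omega : s ≤ 2 * r)]; ring,
    Ring.choose_natCast]

end Literature.NumberTheory.DiophantineApproximation
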